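import Mathlib
import HarnessLib
import Literature.MathematicalPhysics.QuantumFieldTheory.ConstructiveQFTWave0

/-!
# LatticeQCDFlow / Scaling — the lattice half of the entropy budget, TYPED
(THEORY-2.md §4 T2-AH(b)–(d), R-T2-10)

HONEST FRAMING: exact (Metropolis-corrected) sampling algorithms for lattice gauge theory;
figures of merit are autocorrelation/cost numbers at stated couplings and volumes; no
continuum-physics claim.

Typed statements (`def … : Prop`) over the tree's torus vocabulary
`Literature.MathematicalPhysics.QuantumFieldTheory.{GaugeConfig, Edge, Plaquette,
plaquetteHolonomy, wilsonAction, haarProbability, wilsonWeight, partitionFunction, wilsonMeasure}`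
(ConstructiveQFTWave0 §S11: Wilson action `S(U) = Σ_p (N − Re tr ρ(U_p))`, product Haar
reference).  Paper proofs: THEORY-2.md §3.2 v2.0 (b)–(d).  Each statement carries the hypotheses
that make the vocabulary meaningful (`Continuous ρ`, `Re tr ρ(g) ≤ N`, i.e. `S ≥ 0`), so that
`partitionFunction ρ β < ∞` for `β ≥ 0` and no `toReal` junk value can make a statement vacuous
or false.  Tagged `@[conjecture]` (= obligation nodes of OUR theory, provable / refutable by name
— the tree's class for not-yet-proved venture statements, as in `Scaling/Conjectures.lean`; none
is a Literature fact): T-CANDIDATES, i.e. statements theory-2 asserts are routine theorems (paper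
proofs cited per decl), filed for R-T2-10; `SmallBallBound` is PROVED below (`smallBallBound`)
and `PeelingBound` is PROVED in `Scaling/LatticePeeling.lean` (`peelingBound`).
Each `Prop` quantifies over the group, its structure and the representation INSIDE (the style of
`Scaling/Barriers.lean`), so that a proof `theorem x : X d` carries no hypotheses at all.  All
but `SmallBallBound` also assume `SecondCountableTopology G` (true for every compact Lie group):
it makes continuous functions of finitely many links measurable for the PRODUCT σ-algebra of
`GaugeConfig`, which Tonelli (peeling), the gauge-fixing change of variables (tree gauge) and
the Radon–Nikodym form of the relative entropy need; `SmallBallBound` needs monotonicity only.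
-/

namespace Summit.Ventures.LatticeQCDFlow.Theory2.Lattice

open MeasureTheory Literature.MathematicalPhysics.QuantumFieldTheory

variable {N : ℕ} {G : Type*} [Group G] [TopologicalSpace G] [IsTopologicalGroup G] [CompactSpace G]
  [MeasurableSpace G] [BorelSpace G] (ρ : G →* Matrix (Fin N) (Fin N) ℂ)

/-- The one-plaquette partition function `Z₁(β) = ∫_G exp(−β·(N − Re tr ρ(g))) dHaar(g)`
(the `d = 2`, one-plaquette Wilson theory; for `U(1)` it is `e^{−β}·I₀(β)`), written as the
`toReal` of a lower Lebesgue integral (the integrand is non-negative; for `β ≥ 0` and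
`Re tr ρ ≤ N` it is `≤ 1`, so the integral is finite and this is the Bochner integral).
[folklore] -/
noncomputable def onePlaquetteZ (β : ℝ) : ℝ :=
  (∫⁻ g, ENNReal.ofReal (Real.exp (-(β * ((N : ℝ) - (ρ g).trace.re))))
    ∂(haarProbability G)).toReal

/-- **T2-AH(b) PEELING BOUND** (PROVED: `Scaling/LatticePeeling.lean`, `peelingBound`;
THEORY-2.md §3.2 v2.0 (b)).  On the torus `(ℤ/L)^d`, `L ≥ 2`, `β ≥ 0`, for a continuous
representation with `Re tr ρ ≤ N` (so every plaquette weight is `≤ 1`): `Z_Λ(β) ≤ Z₁(β)^m` with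
`m = (d−1)·L^{d−1}·(L−1)` — drop all plaquettes except the temporal ones below the top time
slice and integrate their private upper spatial links one at a time from the top, using trace
cyclicity and left invariance of Haar measure.  Consequence:
`log Z_Λ(β) ≤ (d−1)V(1 − 1/L)·log Z₁(β)`, and for `U(1)` `Z₁(β) ≤ √(π/(8β))`. [folklore] -/
@[conjecture]
def PeelingBound (d : ℕ) : Prop :=
  ∀ (N : ℕ) (G : Type) [Group G] [TopologicalSpace G] [IsTopologicalGroup G] [CompactSpace G]
    [SecondCountableTopology G] [MeasurableSpace G] [BorelSpace G]
    (ρ : G →* Matrix (Fin N) (Fin N) ℂ),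
    Continuous (ρ : G → Matrix (Fin N) (Fin N) ℂ) → (∀ g, (ρ g).trace.re ≤ N) →
    ∀ (L : ℕ) [NeZero L], 2 ≤ L → ∀ β : ℝ, 0 ≤ β →
      (partitionFunction (d := d) (L := L) ρ β).toReal ≤
        onePlaquetteZ ρ β ^ ((d - 1) * L ^ (d - 1) * (L - 1))

/-- **T2-AH(c) SMALL-BALL BOUND** (provable; THEORY-2.md §3.2 v2.0 (c), the version WITHOUT gauge
fixing).  For every measurable `B ⊆ G` and every `s` bounding the plaquette action on products of
four elements of `{1} ∪ B ∪ B⁻¹`:  `Z_Λ(β) ≥ Haar(B)^{#edges} · exp(−β·s·#plaquettes)` (`β ≥ 0`):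
restrict every link to `B` and bound the weight below.  (The tree-gauge refinement replaces `#edges
= d·L^d` by `(d−1)·L^d + 1`; with `B` a ball of radius `∝ β^{−1/2}` either gives
`log Z_Λ(β) ≥ −(#free links·dim G/2)·log β − O(L^d)`.) [folklore] -/
@[conjecture]
def SmallBallBound (d : ℕ) : Prop :=
  ∀ (N : ℕ) (G : Type) [Group G] [TopologicalSpace G] [IsTopologicalGroup G] [CompactSpace G]
    [MeasurableSpace G] [BorelSpace G] (ρ : G →* Matrix (Fin N) (Fin N) ℂ),
    Continuous (ρ : G → Matrix (Fin N) (Fin N) ℂ) → (∀ g, (ρ g).trace.re ≤ N) →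
    ∀ (L : ℕ) [NeZero L] (β : ℝ), 0 ≤ β → ∀ (B : Set G), MeasurableSet B → ∀ s : ℝ,
      (∀ g₁ ∈ insert (1 : G) (B ∪ B⁻¹), ∀ g₂ ∈ insert (1 : G) (B ∪ B⁻¹),
        ∀ g₃ ∈ insert (1 : G) (B ∪ B⁻¹), ∀ g₄ ∈ insert (1 : G) (B ∪ B⁻¹),
          (N : ℝ) - (ρ (g₁ * g₂ * g₃ * g₄)).trace.re ≤ s) →
      (haarProbability G B).toReal ^ Fintype.card (Edge d L) *
          Real.exp (-(β * s * Fintype.card (Plaquette d L))) ≤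
        (partitionFunction (d := d) (L := L) ρ β).toReal

/-- **T2-AH(c′) TREE-GAUGE SMALL-BALL BOUND** (provable; THEORY-2.md §3.2 v2.0 (c)).  As
`SmallBallBound` but with the exponent `#edges − (#sites − 1)` = the number of links outside a
spanning tree (`(d−1)·L^d + 1` on the torus): gauge-fix the tree links to `1` (exact: the non-tree
holonomies of a configuration are independent Haar variables and the Wilson weight is gauge
invariant, `wilsonAction_gaugeTransform`), then restrict the free links to `B`.  This is the form
that gives the right `log β` coefficient in every `d ≥ 2`; the gauge-fixing push-forward is the only
non-routine step of R-T2-10. [folklore] -/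
@[conjecture]
def TreeGaugeSmallBallBound (d : ℕ) : Prop :=
  ∀ (N : ℕ) (G : Type) [Group G] [TopologicalSpace G] [IsTopologicalGroup G] [CompactSpace G]
    [SecondCountableTopology G] [MeasurableSpace G] [BorelSpace G]
    (ρ : G →* Matrix (Fin N) (Fin N) ℂ),
    Continuous (ρ : G → Matrix (Fin N) (Fin N) ℂ) → (∀ g, (ρ g).trace.re ≤ N) →
    ∀ (L : ℕ) [NeZero L] (β : ℝ), 0 ≤ β → ∀ (B : Set G), MeasurableSet B → ∀ s : ℝ,
      (∀ g₁ ∈ insert (1 : G) (B ∪ B⁻¹), ∀ g₂ ∈ insert (1 : G) (B ∪ B⁻¹),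
        ∀ g₃ ∈ insert (1 : G) (B ∪ B⁻¹), ∀ g₄ ∈ insert (1 : G) (B ∪ B⁻¹),
          (N : ℝ) - (ρ (g₁ * g₂ * g₃ * g₄)).trace.re ≤ s) →
      (haarProbability G B).toReal ^ (Fintype.card (Edge d L) - (Fintype.card (Site d L) - 1)) *
          Real.exp (-(β * s * Fintype.card (Plaquette d L))) ≤
        (partitionFunction (d := d) (L := L) ρ β).toReal

/-- **T2-AH(d) ENTROPY GROWTH** (provable from `PeelingBound`, `TreeGaugeSmallBallBound`,
`GibbsIdentity` and the two-free-energies bound `Theory2.klFin_tiltLaw_ge` transcribed to measures;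
THEORY-2.md §3.2 v2.0 (d)).  HYPOTHESES, besides continuity and `Re tr ρ ≤ N`: (H1) one-plaquette
decay `Z₁(β) ≤ A·β^{−κ/2}` (`β > 0`); (H2) small balls — for every `0 < ε ≤ 1` a measurable `B ⊆ G`
of Haar mass `≥ a·ε^κ` on whose four-fold products (with `1` and inverses) the plaquette action is
`≤ b·ε²`.  Both hold with `κ = dim G` for a faithful continuous unitary `ρ` (`U(1)`: `κ = 1`,
`Z₁(β) ≤ √(π/(8β))`, `B = ` arc of half-width `ε`, mass `ε/π`, action `≤ 8ε²`; `SU(N)`: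
`κ = N² − 1`; `U(N)`: `κ = N²`) and FAIL for the trivial representation (then `D = 0`: no vacuous
instance is claimed).  CONCLUSION: for `β ≥ 1`, `L ≥ 2`, with `V = L^d`,
`κ·[(d−1)V(1/2 − 1/L) − 1/2]·log β − C·V ≤ D(μ_{Λ,β} ‖ Haar^{⊗E}) ≤ κ·((d−1)V + 1)/2·log β + C·V`:
the entropy deficit of the Wilson measure is `(n_tr/2)·log β·(1 ± O(1/L)) + O(V)`,
`n_tr = κ·(d−1)·V` transverse degrees of freedom.  The sharp `U(N)` constant on the free box is
Chatterjee, J. Funct. Anal. 271 (2016), Thm 2.1 with Brennecke arXiv:2511.07297 Thm 2 — not claimed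
here. [folklore] -/
@[conjecture]
def EntropyGrowth (d : ℕ) (κ : ℝ) : Prop :=
  ∀ (N : ℕ) (G : Type) [Group G] [TopologicalSpace G] [IsTopologicalGroup G] [CompactSpace G]
    [SecondCountableTopology G] [MeasurableSpace G] [BorelSpace G]
    (ρ : G →* Matrix (Fin N) (Fin N) ℂ),
    Continuous (ρ : G → Matrix (Fin N) (Fin N) ℂ) → (∀ g, (ρ g).trace.re ≤ N) →
    (∃ A : ℝ, ∀ β : ℝ, 0 < β → onePlaquetteZ ρ β ≤ A * β ^ (-(κ / 2))) →
    (∃ a b : ℝ, 0 < a ∧ ∀ ε : ℝ, 0 < ε → ε ≤ 1 → ∃ B : Set G, MeasurableSet B ∧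
        a * ε ^ κ ≤ (haarProbability G B).toReal ∧
        ∀ g₁ ∈ insert (1 : G) (B ∪ B⁻¹), ∀ g₂ ∈ insert (1 : G) (B ∪ B⁻¹),
          ∀ g₃ ∈ insert (1 : G) (B ∪ B⁻¹), ∀ g₄ ∈ insert (1 : G) (B ∪ B⁻¹),
            (N : ℝ) - (ρ (g₁ * g₂ * g₃ * g₄)).trace.re ≤ b * ε ^ 2) →
    ∃ C : ℝ, ∀ (L : ℕ) [NeZero L], 2 ≤ L → ∀ β : ℝ, 1 ≤ β →
      κ * (((d : ℝ) - 1) * (L : ℝ) ^ d * (1 / 2 - 1 / L) - 1 / 2) * Real.log β - C * (L : ℝ) ^ d ≤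
          (InformationTheory.klDiv (wilsonMeasure (d := d) (L := L) ρ β)
              (Measure.pi fun _ : Edge d L => haarProbability G)).toReal ∧
        (InformationTheory.klDiv (wilsonMeasure (d := d) (L := L) ρ β)
              (Measure.pi fun _ : Edge d L => haarProbability G)).toReal ≤
          κ * ((((d : ℝ) - 1) * (L : ℝ) ^ d + 1) / 2) * Real.log β + C * (L : ℝ) ^ d

/-- **Gibbs identity on the lattice** (provable; the measure form of `Theory2.klFin_tiltLaw`):
`D(μ_{Λ,β} ‖ Haar^{⊗E}) = −β·⟨S⟩_{Λ,β} − log Z_Λ(β)` for `β ≥ 0`, continuous `ρ` with `Re tr ρ ≤ N`.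
[folklore] -/
@[conjecture]
def GibbsIdentity (d : ℕ) : Prop :=
  ∀ (N : ℕ) (G : Type) [Group G] [TopologicalSpace G] [IsTopologicalGroup G] [CompactSpace G]
    [SecondCountableTopology G] [MeasurableSpace G] [BorelSpace G]
    (ρ : G →* Matrix (Fin N) (Fin N) ℂ),
    Continuous (ρ : G → Matrix (Fin N) (Fin N) ℂ) → (∀ g, (ρ g).trace.re ≤ N) →
    ∀ (L : ℕ) [NeZero L] (β : ℝ), 0 ≤ β →
      (InformationTheory.klDiv (wilsonMeasure (d := d) (L := L) ρ β)
          (Measure.pi fun _ : Edge d L => haarProbability G)).toReal =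
        -(β * wilsonExpectation (d := d) (L := L) ρ β (wilsonAction (d := d) (L := L) ρ)) -
          Real.log (partitionFunction (d := d) (L := L) ρ β).toReal

end Summit.Ventures.LatticeQCDFlow.Theory2.Lattice

/-! ## Proofs (R-T2-10 first instalments): the Haar reference is a probability measure; the Wilson
weight is finite for `β ≥ 0`, `Re tr ρ ≤ N`; `SmallBallBound` holds. -/

namespace Summit.Ventures.LatticeQCDFlow.Theory2.Lattice

open MeasureTheory Literature.MathematicalPhysics.QuantumFieldTheory

variable {N : ℕ} {G : Type*} [Group G] [TopologicalSpace G] [IsTopologicalGroup G] [CompactSpace G]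
  [MeasurableSpace G] [BorelSpace G] (ρ : G →* Matrix (Fin N) (Fin N) ℂ)

/-- The normalised Haar measure of a compact group (`haarMeasure ⊤`) is a probability measure.
[folklore] -/
instance isProbabilityMeasure_haarProbability : IsProbabilityMeasure (haarProbability G) := by
  refine ⟨?_⟩
  have h := Measure.haarMeasure_self (G := G) (K₀ := ⊤)
  rwa [TopologicalSpace.PositiveCompacts.coe_top] at h

omit [TopologicalSpace G] [IsTopologicalGroup G] [CompactSpace G] [MeasurableSpace G]
  [BorelSpace G] in
/-- The Wilson action is non-negative when `Re tr ρ(g) ≤ N` for all `g` (each plaquette term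
`N − Re tr ρ(U_p) ≥ 0`). [folklore] -/
theorem wilsonAction_nonneg {d L : ℕ} [NeZero L] (htr : ∀ g, (ρ g).trace.re ≤ N)
    (U : GaugeConfig d L G) : 0 ≤ wilsonAction ρ U := by
  unfold wilsonAction
  exact Finset.sum_nonneg fun p _ => sub_nonneg.mpr (htr _)

/-- For `β ≥ 0` and `Re tr ρ ≤ N` the partition function is at most `1` (the weight `e^{−βS} ≤ 1`
against a probability measure); in particular it is finite. [folklore] -/
theorem partitionFunction_le_one {d L : ℕ} [NeZero L] (htr : ∀ g, (ρ g).trace.re ≤ N) {β : ℝ}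
    (hβ : 0 ≤ β) : partitionFunction (d := d) (L := L) ρ β ≤ 1 := by
  unfold partitionFunction wilsonWeight
  rw [withDensity_apply _ MeasurableSet.univ, Measure.restrict_univ]
  calc ∫⁻ U, ENNReal.ofReal (Real.exp (-β * wilsonAction ρ U))
        ∂(Measure.pi fun _ : Edge d L => haarProbability G)
      ≤ ∫⁻ _, 1 ∂(Measure.pi fun _ : Edge d L => haarProbability G) := by
        refine lintegral_mono fun U => ?_
        rw [← ENNReal.ofReal_one]
        refine ENNReal.ofReal_le_ofReal ?_
        rw [← Real.exp_zero]
        refine Real.exp_le_exp.mpr ?_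
        have := wilsonAction_nonneg ρ htr U
        nlinarith
    _ = 1 := by rw [lintegral_one, measure_univ]

/-- **`SmallBallBound` holds** (T2-AH(c), the version without gauge fixing): restrict every link to
`B` and bound the Wilson weight below by `exp(−β·s·#plaquettes)` there. [folklore] -/
theorem smallBallBound (d : ℕ) : SmallBallBound d := by
  intro N G _ _ _ _ _ _ ρ _ htr L _ β hβ B hB s hs
  classical
  have hAm : MeasurableSet (Set.pi Set.univ fun _ : Edge d L => B) :=
    MeasurableSet.univ_pi fun _ => hB
  -- the action on configurations with all links in `B`
  have hS : ∀ U ∈ Set.pi Set.univ (fun _ : Edge d L => B),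
      wilsonAction ρ U ≤ s * Fintype.card (Plaquette d L) := by
    intro U hU
    have hUB : ∀ e, U e ∈ B := fun e => hU e (Set.mem_univ e)
    have hmem : ∀ e, U e ∈ insert (1 : G) (B ∪ B⁻¹) := fun e =>
      Set.mem_insert_of_mem _ (Set.mem_union_left _ (hUB e))
    have hmem' : ∀ e, (U e)⁻¹ ∈ insert (1 : G) (B ∪ B⁻¹) := fun e =>
      Set.mem_insert_of_mem _ (Set.mem_union_right _ (Set.inv_mem_inv.mpr (hUB e)))
    unfold wilsonAction
    calc ∑ p : Plaquette d L,
          ((N : ℝ) - (ρ (plaquetteHolonomy U p.1 p.2.1.1 p.2.1.2)).trace.re)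
        ≤ ∑ _p : Plaquette d L, s := Finset.sum_le_sum fun p _ => by
          unfold plaquetteHolonomy
          exact hs _ (hmem _) _ (hmem _) _ (hmem' _) _ (hmem' _)
      _ = s * Fintype.card (Plaquette d L) := by
          rw [Finset.sum_const, Finset.card_univ, nsmul_eq_mul, mul_comm]
  -- the ENNReal inequality
  have hZ : ENNReal.ofReal (Real.exp (-(β * s * Fintype.card (Plaquette d L)))) *
      haarProbability G B ^ Fintype.card (Edge d L) ≤ partitionFunction (d := d) (L := L) ρ β := by
    unfold partitionFunction wilsonWeight
    rw [withDensity_apply _ MeasurableSet.univ, Measure.restrict_univ]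
    have hpi : (Measure.pi fun _ : Edge d L => haarProbability G) (Set.pi Set.univ fun _ => B) =
        haarProbability G B ^ Fintype.card (Edge d L) := by
      rw [Measure.pi_pi, Finset.prod_const, Finset.card_univ]
    rw [← hpi, ← lintegral_indicator_const hAm]
    refine lintegral_mono fun U => ?_
    by_cases hU : U ∈ Set.pi Set.univ (fun _ : Edge d L => B)
    · rw [Set.indicator_of_mem hU]
      refine ENNReal.ofReal_le_ofReal (Real.exp_le_exp.mpr ?_)
      have h1 := hS U hU
      have h2 : β * wilsonAction ρ U ≤ β * (s * Fintype.card (Plaquette d L)) :=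
        mul_le_mul_of_nonneg_left h1 hβ
      linarith
    · rw [Set.indicator_of_notMem hU]
      exact zero_le
  -- pass to real numbers
  have hfin : partitionFunction (d := d) (L := L) ρ β ≠ ⊤ :=
    ne_top_of_le_ne_top ENNReal.one_ne_top (partitionFunction_le_one ρ htr hβ)
  have hlhs : (ENNReal.ofReal (Real.exp (-(β * s * Fintype.card (Plaquette d L)))) *
      haarProbability G B ^ Fintype.card (Edge d L)).toReal =
      (haarProbability G B).toReal ^ Fintype.card (Edge d L) *
        Real.exp (-(β * s * Fintype.card (Plaquette d L))) := by
    rw [ENNReal.toReal_mul, ENNReal.toReal_pow, ENNReal.toReal_ofReal (Real.exp_nonneg _), mul_comm]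
  rw [← hlhs]
  exact (ENNReal.toReal_le_toReal (ENNReal.mul_ne_top ENNReal.ofReal_ne_top
    (ENNReal.pow_ne_top (measure_ne_top _ _))) hfin).mpr hZ

end Summit.Ventures.LatticeQCDFlow.Theory2.Lattice
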